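import Summits.CriticalPhenomena.PercolationContinuityZ3.Theorems.PercNearOneGluingNoHeavyLowerTailSunflowerMultiPetalKempeMarked
import HarnessLib
import HarnessLib.Audit

/-!
# `NoHeavyLowerTail` (crux stmt-CriticalPhenomena-4575), marked-multigraph layer: the ONE-POINT SPLITTING of the member count at a vertex

Support file (seat `prim-l12-p2` gen 47; `--supports stmt-CriticalPhenomena-4575`; continuation of `…KempeMarked` (p594349: `MGraph`, `cntM`, `isolate`)).
No `sorry`; nothing is asserted about the crux.  Memo: run/shared/lean/prim/prim-l12/prim-l12-p2/FINDING-g47-NEIGHBOURHOOD-CONTRACTION-STEP.md §6.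

`cntM_eq_isolate_add`: for every colouring `σ` and colour `c`, the number of `c`-monochromatic members of `K` is the number in `K.isolate y`
(the members avoiding `y`) plus, when `σ y = c`, the multiplicity-weighted number of `c`-coloured neighbours of `y` (`linkM`) and the marks of `y`.
This is the first step of the one-point (vertex-peeling) decomposition `3·T(K) − T(K.isolate y) = Σ_σ kerTAbs (type, profile)` of the same-vertex-type
formalization plan (memo §6; HOME/lean-g47/KempeMarkedSkeleton.lean).
-/

namespace Summit.CriticalPhenomena.PercolationContinuityZ3.Theorems.SunflowerPartition.Kempe

open Finset

namespace MGraph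

variable {V : Type*} [Fintype V] [LinearOrder V] (K : MGraph V)

/-! ## The one-point decomposition at a vertex `y` (same vertex type) -/

section OnePoint

variable (y : V)

/-- The multiplicity-weighted number of `c`-coloured neighbours of `y`. [this work] -/
def linkM (σ : V → Fin 3) (c : Fin 3) : ℕ := ∑ w, if σ w = c then K.mul y w else 0

/-- Splitting the ordered-pair sum of `cntM` into the pairs avoiding `y` (those of `K.isolate y`) and the pairs at `y`. [this work] -/
theorem cntM_eq_isolate_add (σ : V → Fin 3) (c : Fin 3) :
    K.cntM σ c = (K.isolate y).cntM σ c + (if σ y = c then K.linkM y σ c + K.mark y else 0) := by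
  unfold cntM linkM isolate
  simp only
  -- marks
  have hmark : (∑ x, if σ x = c then K.mark x else 0)
      = (∑ x, if σ x = c then (if x = y then 0 else K.mark x) else 0) + (if σ y = c then K.mark y else 0) := by
    rw [← Finset.sum_erase_add _ _ (mem_univ y)]
    have h1 : (∑ x ∈ univ.erase y, if σ x = c then K.mark x else 0) = ∑ x ∈ univ.erase y, if σ x = c then (if x = y then 0 else K.mark x) else 0 :=
      sum_congr rfl fun x hx => by rw [if_neg (ne_of_mem_erase hx)]
    rw [h1, ← Finset.sum_erase_add (univ : Finset V) (fun x => if σ x = c then (if x = y then 0 else K.mark x) else 0) (mem_univ y)]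
    simp
  -- pairs touching y, pointwise in the other endpoint w
  have hrow : ∀ w : V, (if y < w ∧ σ y = c ∧ σ w = c then K.mul y w else 0) + (if w < y ∧ σ w = c ∧ σ y = c then K.mul w y else 0)
      = (if σ y = c ∧ σ w = c then K.mul y w else 0) := by
    intro w
    rcases lt_trichotomy y w with h | h | h
    · have h2 : ¬(w < y) := not_lt.2 h.le
      by_cases hc : σ y = c ∧ σ w = c
      · simp [h, h2, hc]
      · simp [h2, hc]
    · subst h
      simp [K.loopless]
    · have h2 : ¬(y < w) := not_lt.2 h.le
      by_cases hc : σ y = c ∧ σ w = c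
      · simp [h, h2, hc, K.symm]
      · have : ¬(w < y ∧ σ w = c ∧ σ y = c) := fun hh => hc ⟨hh.2.2, hh.2.1⟩
        simp [this, h2, hc]
  have hpair : (∑ x, ∑ z, if x < z ∧ σ x = c ∧ σ z = c then K.mul x z else 0)
      = (∑ x, ∑ z, if x < z ∧ σ x = c ∧ σ z = c then (if x = y ∨ z = y then 0 else K.mul x z) else 0)
        + (if σ y = c then ∑ w, (if σ w = c then K.mul y w else 0) else 0) := by
    have key : ∀ x z : V, (if x < z ∧ σ x = c ∧ σ z = c then K.mul x z else 0)
        = (if x < z ∧ σ x = c ∧ σ z = c then (if x = y ∨ z = y then 0 else K.mul x z) else 0)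
          + ((if x = y then (if y < z ∧ σ y = c ∧ σ z = c then K.mul y z else 0) else 0)
             + (if z = y then (if x < y ∧ σ x = c ∧ σ y = c then K.mul x y else 0) else 0)) := by
      intro x z
      by_cases hx : x = y
      · subst hx
        by_cases hz : z = x
        · subst hz; simp
        · by_cases h : x < z ∧ σ x = c ∧ σ z = c
          · simp [h, hz]
          · simp [h, hz]
      · by_cases hz : z = y
        · subst hz
          by_cases h : x < z ∧ σ x = c ∧ σ z = c
          · simp [h, hx]
          · simp [h, hx]
        · by_cases h : x < z ∧ σ x = c ∧ σ z = c
          · simp [h, hx, hz]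
          · simp [h, hx, hz]
    have hsplit : (∑ x, ∑ z, ((if x = y then (if y < z ∧ σ y = c ∧ σ z = c then K.mul y z else 0) else 0)
             + (if z = y then (if x < y ∧ σ x = c ∧ σ y = c then K.mul x y else 0) else 0)))
        = ∑ w, ((if y < w ∧ σ y = c ∧ σ w = c then K.mul y w else 0) + (if w < y ∧ σ w = c ∧ σ y = c then K.mul w y else 0)) := by
      rw [sum_add_distrib]
      simp_rw [sum_add_distrib]
      congr 1
      · rw [Finset.sum_comm]
        refine sum_congr rfl fun w _ => ?_
        rw [Finset.sum_ite_eq' univ y]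
        simp
      · refine sum_congr rfl fun w _ => ?_
        rw [Finset.sum_ite_eq' univ y]
        simp
    have hconst : (if σ y = c then ∑ w, (if σ w = c then K.mul y w else 0) else 0) = ∑ w, (if σ y = c ∧ σ w = c then K.mul y w else 0) := by
      by_cases hc : σ y = c
      · simp [hc]
      · simp [hc]
    calc (∑ x, ∑ z, if x < z ∧ σ x = c ∧ σ z = c then K.mul x z else 0)
        = ∑ x, ∑ z, ((if x < z ∧ σ x = c ∧ σ z = c then (if x = y ∨ z = y then 0 else K.mul x z) else 0)
          + ((if x = y then (if y < z ∧ σ y = c ∧ σ z = c then K.mul y z else 0) else 0)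
             + (if z = y then (if x < y ∧ σ x = c ∧ σ y = c then K.mul x y else 0) else 0))) :=
          sum_congr rfl fun x _ => sum_congr rfl fun z _ => key x z
      _ = (∑ x, ∑ z, if x < z ∧ σ x = c ∧ σ z = c then (if x = y ∨ z = y then 0 else K.mul x z) else 0)
          + ∑ x, ∑ z, ((if x = y then (if y < z ∧ σ y = c ∧ σ z = c then K.mul y z else 0) else 0)
             + (if z = y then (if x < y ∧ σ x = c ∧ σ y = c then K.mul x y else 0) else 0)) := by
          rw [← sum_add_distrib]; exact sum_congr rfl fun x _ => sum_add_distrib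
      _ = _ := by rw [hsplit, sum_congr rfl (fun w _ => hrow w), hconst]
  rw [hmark, hpair]
  by_cases hc : σ y = c
  · simp only [hc, if_true]; ring
  · simp only [hc, if_false]; ring

end OnePoint

end MGraph

end Summit.CriticalPhenomena.PercolationContinuityZ3.Theorems.SunflowerPartition.Kempe
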